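import Literature.RepresentationTheory.FiniteGroups.PermutationCharacter
import Literature.RepresentationTheory.FiniteGroups.GroupAlgebraCharacterIdempotents
import Literature.RepresentationTheory.FiniteGroups.RationalGroupAlgebraCentralIdempotents
import HarnessLib

/-!
# Isotypical multiplicities in a permutation module: `dim_ℂ (z · ℂ[S]) = Σ_g z_g |S^g|` for an idempotent `z ∈ ℂ[G]`,
# `N · dim_ℂ (e · ℂ[S]) = Σ_g c_g |S^g|` for a rational idempotent with `N e = Σ_g c_g g ∈ ℤ[G]`, and `Σ_i dim (e_i ℂ[S]) = |S|`

For a finite group `G`, a finite `G`-set `S` with permutation module `ℂ[S] = ℂS` (Mathlib's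
`Representation.ofMulAction ℂ G S` on `MonoidAlgebra ℂ S = ℂS`, permutation character `π(g) = |S^g|`, the tree's
`character_ofMulAction_eq_natCard_fixedBy`) and an element `z = Σ_g z_g g ∈ ℂ[G]`:

* `tr(z | ℂ[S]) = Σ_g z_g |S^g|` (the tree's "calculation of traces" `tr(ρ(z)) = Σ_g z_g χ_ρ(g)`, Isaacs p. 36, with `χ = π`);
* for an IDEMPOTENT `z` (e.g. Serre's projection `p_i = (n_i/g) Σ_t χ_i(t)^* ρ_t` onto an isotypical component, §2.6 Thm. 8 (ii),
  or a rational central idempotent `e_W`): **`dim_ℂ (z · V) = tr(z | V) = Σ_g z_g χ_V(g)`** for every finite-dimensional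
  representation `V` (the trace of a projection is the rank of its image), so **`dim_ℂ (z · ℂ[S]) = Σ_g z_g |S^g|`**;
* for a rational idempotent `e ∈ ℚ[G]` with cleared denominator `N · e = Σ_g c_g g`, `c_g ∈ ℤ` (Lange–Rodríguez: "`m` some positive
  integer such that `mα ∈ ℤ[G]`"; for `e = e_W` one may take `N = |G|`, `Motives/AbelianVarietyGroupActionIsotypicalDecomposition`):
  **`N · dim_ℂ (e · ℂ[S]) = Σ_g c_g |S^g|`** — in particular the integer `Σ_g c_g |S^g|` is a non-negative multiple of `N`;
* for a complete family of orthogonal idempotents `Σ_i e_i = 1` in `ℚ[G]`: **`Σ_i dim_ℂ (e_i · ℂ[S]) = |S|`**;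
* §4 in terms of characters: for the rational central idempotent `e_W = e_ℚ(χ) = Σ_{ψ ∈ 𝒮(χ)} e_ψ` of an irreducible `χ` with
  Galois class `𝒮(χ)` (the tree's `ratCharIdempotent`, `galoisClassIdempotent`, `isotypicProj`):
  **`dim_ℂ (e_W · V) = Σ_{ψ ∈ 𝒮(χ)} ψ(1) ⟨ψ, χ_V⟩`** for every finite-dimensional `V` (Serre Thm. 8 (ii): `tr p_ψ = n_ψ ⟨ψ, χ_V⟩`),
  on `ℂ[S]`: `= Σ_{ψ ∈ 𝒮(χ)} ψ(1) ⟨ψ, π⟩`, and for the trivial character `dim (e_1 · ℂ[S]) = |G\S|` (Burnside);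
* §5 DOUBLY TRANSITIVE actions (`π = 1 + θ`, `θ` irreducible, James–Liebeck 29.10 — the tree's
  `exists_isIrrChar_eq_one_add_of_isMultiplyPretransitive`): the permutation characters `π`, `θ` are alone in their Galois
  classes (`|S^{g^m}| = |S^g|` for `(m, |G|) = 1`), **`dim (e_θ · ℂ[S]) = |S| − 1`**, and **`dim (e_W · ℂ[S]) = 0`** for every
  irreducible `χ ∉ {1, θ}`: the isotypical decomposition of `ℂ[S]` is `1 ⊕ θ`;
* §6 the REGULAR module `S = G` (left multiplication; `π_reg = |G| · δ_1`, `⟨ψ, π_reg⟩ = ψ(1)`): **`dim (e_W · ℂ[G]) = |𝒮(χ)| · χ(1)²`**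
  (`= [ℚ(χ):ℚ] · χ(1)²`, the dimension of the simple component `ℚ[G] e_W ⊗ ℂ = ⊕_{ψ ∈ 𝒮(χ)} M_{χ(1)}(ℂ)`), in particular `> 0`:
  every irreducible rational representation occurs in `ℚ[G]` (Serre §2.4 Cor. 1);
* §7 the COSET modules `S = G/H` (`π_{G/H} = Ind_H^G 1_H`, Isaacs 5.14 — the tree's `indClassFun_one_eq_natCard_fixedBy_quotient`;
  Frobenius reciprocity `⟨ψ, Ind 1⟩_G = ⟨Res ψ, 1⟩_H`, Serre §7.2 Thm. 13 — the tree's `classInner_indClassFun_right`):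
  **`dim (e_W · ℂ[G/H]) = Σ_{ψ ∈ 𝒮(χ)} ψ(1) ⟨Res_H ψ, 1_H⟩_H = |𝒮(χ)| · χ(1) · ⟨Res_H χ, 1_H⟩_H`** (`⟨Res_H χ, 1_H⟩_H = dim V_χ^H` is
  constant on the Galois class), interpolating §6 (`H = 1`) and the trivial/2-transitive cases.

These identify the exponents `m_W` of the isotypical decomposition of a permutation power of an abelian variety
(`Motives/AbelianVarietyPermutationPowerIsotypical`: `B_W(A^S) ∼ A^{m_W}` for `|G| m_W = Σ_g c_W(g)|S^g|`) with the dimensions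
`dim (e_W · ℚ[S])` of the isotypical components of the permutation representation.  Everything is a theorem (no definitions).

## References

* [SerreLinearRepresentations1977] J.-P. Serre, *Linear Representations of Finite Groups*, GTM 42 (1977), §2.3 Ex. 2.2
  (permutation character), §2.6 Thm. 8 (ii) (p. 21: `p_i = (n_i/g) Σ_t χ_i(t)^* ρ_t` is the projection onto `V_i`).
* [Isaacs1976] I. M. Isaacs, *Character Theory of Finite Groups* (1976), Ch. 3 p. 36 (traces of group-algebra elements),
  Cor. 5.15 (Burnside's count).
* [JamesLiebeck2001] G. James, M. Liebeck, *Representations and Characters of Groups*, 2nd ed. (2001), Ch. 29 p. 340 (`π(g) = |fix(g)|`),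
  Prop. 29.4 (Burnside), Cor. 29.10 (2-transitive `⟺ π = 1 + χ`).
* [LangeRodriguez2022] H. Lange, R. E. Rodríguez, *Decomposition of Jacobians by Prym Varieties*, LNM 2310 (2022), §2.8
  (2.22)–(2.23), §2.9.1 (PDF pp. 40, 43).
-/

noncomputable section

open scoped BigOperators
open Module MulAction

namespace Literature.RepresentationTheory.FiniteGroups

variable {G : Type} [Group G] [Fintype G] {S : Type} [Fintype S] [MulAction G S]

/-! ## §1 Traces and ranks of group-algebra elements on `ℂ[S]` -/

/-- **`tr(z | ℂ[S]) = Σ_g z_g · |S^g|`** for `z = Σ_g z_g g ∈ ℂ[G]` acting on the permutation module.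
[cite: Isaacs1976, Ch. 3 p. 36] [cite: SerreLinearRepresentations1977, §2.3 Ex. 2.2] -/
theorem trace_asAlgebraHom_ofMulAction_eq (z : MonoidAlgebra ℂ G) :
    LinearMap.trace ℂ (MonoidAlgebra ℂ S) ((Representation.ofMulAction ℂ G S).asAlgebraHom z) =
      ∑ g, z.coeff g * (Nat.card (fixedBy S g) : ℂ) := by
  rw [Representation.trace_asAlgebraHom]
  simp_rw [character_ofMulAction_eq_natCard_fixedBy]

/-- **The rank of an idempotent of `ℂ[G]` on a representation is its trace: `dim_ℂ (z · V) = Σ_g z_g χ_V(g)`** for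
`z² = z` (`ρ(z)` is then a projection of `V` onto `z · V = range ρ(z)`, and the trace of a projection is the dimension of its
image — Serre's `p_i` of Thm. 8 (ii) is the case `z = (n_i/g) Σ_t χ_i(t)^* t`). [cite: SerreLinearRepresentations1977, §2.6 Thm. 8 (ii)]
[cite: Isaacs1976, Ch. 3 p. 36] -/
theorem finrank_range_asAlgebraHom_eq_of_isIdempotentElem {V : Type} [AddCommGroup V] [Module ℂ V]
    [FiniteDimensional ℂ V] (ρ : Representation ℂ G V) {z : MonoidAlgebra ℂ G} (hz : IsIdempotentElem z) :
    (finrank ℂ (LinearMap.range (ρ.asAlgebraHom z)) : ℂ) = ∑ g, z.coeff g * ρ.character g := by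
  have hP : IsIdempotentElem (ρ.asAlgebraHom z) := by
    rw [IsIdempotentElem, ← map_mul, hz.eq]
  have hproj : LinearMap.IsProj (LinearMap.range (ρ.asAlgebraHom z)) (ρ.asAlgebraHom z) :=
    LinearMap.IsIdempotentElem.isProj_range _ hP
  rw [← Representation.trace_asAlgebraHom ρ z, hproj.trace]

/-- **`dim_ℂ (z · ℂ[S]) = Σ_g z_g · |S^g|` for an idempotent `z ∈ ℂ[G]`** on the permutation module.
[cite: SerreLinearRepresentations1977, §2.6 Thm. 8 (ii) and §2.3 Ex. 2.2] -/
theorem finrank_range_asAlgebraHom_ofMulAction_eq {z : MonoidAlgebra ℂ G} (hz : IsIdempotentElem z) :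
    (finrank ℂ (LinearMap.range ((Representation.ofMulAction ℂ G S).asAlgebraHom z)) : ℂ) =
      ∑ g, z.coeff g * (Nat.card (fixedBy S g) : ℂ) := by
  rw [finrank_range_asAlgebraHom_eq_of_isIdempotentElem _ hz]
  simp_rw [character_ofMulAction_eq_natCard_fixedBy]

/-! ## §2 Rational idempotents with cleared denominators: `N · dim (e · ℂ[S]) = Σ_g c_g |S^g|` -/

/-- Coefficient extraction: `(Σ_h f(h) h)_g = f(g)` in `ℚ[G]`. [folklore] -/
private theorem coeff_sum_smul_of_rat (f : G → ℚ) (g : G) :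
    (∑ h : G, f h • MonoidAlgebra.of ℚ G h).coeff g = f g := by
  classical
  simp only [MonoidAlgebra.coeff_sum, MonoidAlgebra.coeff_smul, MonoidAlgebra.of_apply,
    MonoidAlgebra.coeff_single, Finsupp.coe_finsetSum, Finsupp.coe_smul, Finset.sum_apply,
    Pi.smul_apply, Finsupp.single_apply, smul_eq_mul, mul_ite, mul_one, mul_zero,
    Finset.sum_ite_eq', Finset.mem_univ, if_true]

/-- From `N · e = Σ_g c_g g`: the coefficients are `N · e_g = c_g`. [cite: LangeRodriguez2022, §2.9.1 (PDF p. 43)] -/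
theorem mul_coeff_eq_of_smul_eq_sum {e : MonoidAlgebra ℚ G} {N : ℕ} {c : G → ℤ}
    (hc : (N : ℚ) • e = ∑ g, (c g : ℚ) • MonoidAlgebra.of ℚ G g) (g : G) :
    (N : ℚ) * e.coeff g = c g := by
  have h := congrArg (fun x : MonoidAlgebra ℚ G ↦ x.coeff g) hc
  rw [coeff_sum_smul_of_rat, MonoidAlgebra.coeff_smul, Finsupp.coe_smul, Pi.smul_apply, smul_eq_mul] at h
  exact h

/-- **`N · dim_ℂ (e · ℂ[S]) = Σ_g c_g · |S^g|`** for an idempotent `e ∈ ℚ[G]` with `N · e = Σ_g c_g g`, `c_g ∈ ℤ` (`e` acting on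
`ℂ[S]` through `ℚ[G] → ℂ[G]`): the dimension of the `e`-component of the permutation representation, cleared of denominators.
For the rational central idempotent `e_W` of an irreducible rational representation `W` and `N = |G|` this is
`|G| · dim (e_W ℂ[S]) = Σ_g c_W(g) |S^g|`. [cite: SerreLinearRepresentations1977, §2.6 Thm. 8 (ii) and §2.3 Ex. 2.2]
[cite: LangeRodriguez2022, §2.8 (2.23) and §2.9.1 (PDF pp. 40, 43)] -/
theorem mul_finrank_range_ofMulAction_eq_sum {e : MonoidAlgebra ℚ G} (he : IsIdempotentElem e) {N : ℕ} {c : G → ℤ}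
    (hc : (N : ℚ) • e = ∑ g, (c g : ℚ) • MonoidAlgebra.of ℚ G g) :
    (N : ℤ) * finrank ℂ (LinearMap.range ((Representation.ofMulAction ℂ G S).asAlgebraHom
        (MonoidAlgebra.mapRingHom G (algebraMap ℚ ℂ) e))) =
      ∑ g, c g * (Nat.card (fixedBy S g) : ℤ) := by
  have h1 := finrank_range_asAlgebraHom_ofMulAction_eq (S := S) ((isIdempotentElem_iff_ratToComplex e).1 he)
  simp_rw [coeff_ratToComplex] at h1
  have hcoef : ∀ g : G, (N : ℂ) * ((e.coeff g : ℚ) : ℂ) = (c g : ℂ) := fun g ↦ by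
    have h := congrArg (fun q : ℚ ↦ (q : ℂ)) (mul_coeff_eq_of_smul_eq_sum hc g)
    rw [Rat.cast_mul, Rat.cast_natCast, Rat.cast_intCast] at h
    exact h
  apply Int.cast_injective (α := ℂ)
  push_cast
  rw [h1, Finset.mul_sum]
  exact Finset.sum_congr rfl fun g _ ↦ by rw [← mul_assoc, hcoef g]

/-- **`Σ_g c_g |S^g|` is a non-negative multiple of `N`**: `∃ m : ℕ, N · m = Σ_g c_g |S^g|` (namely `m = dim_ℂ (e · ℂ[S])`).
[cite: SerreLinearRepresentations1977, §2.6 Thm. 8 (ii)] [cite: LangeRodriguez2022, §2.9.1 (PDF p. 43)] -/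
theorem exists_mul_eq_sum_mul_natCard_fixedBy {e : MonoidAlgebra ℚ G} (he : IsIdempotentElem e) {N : ℕ} {c : G → ℤ}
    (hc : (N : ℚ) • e = ∑ g, (c g : ℚ) • MonoidAlgebra.of ℚ G g) :
    ∃ m : ℕ, (N : ℤ) * m = ∑ g, c g * (Nat.card (fixedBy S g) : ℤ) :=
  ⟨_, mul_finrank_range_ofMulAction_eq_sum he hc⟩

/-- `0 ≤ Σ_g c_g |S^g|` under the same hypotheses. [cite: SerreLinearRepresentations1977, §2.6 Thm. 8 (ii)] -/
theorem sum_mul_natCard_fixedBy_nonneg {e : MonoidAlgebra ℚ G} (he : IsIdempotentElem e) {N : ℕ} {c : G → ℤ}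
    (hc : (N : ℚ) • e = ∑ g, (c g : ℚ) • MonoidAlgebra.of ℚ G g) :
    0 ≤ ∑ g, c g * (Nat.card (fixedBy S g) : ℤ) := by
  rw [← mul_finrank_range_ofMulAction_eq_sum (S := S) he hc]
  positivity

/-! ## §3 A complete family: `Σ_i dim (e_i · ℂ[S]) = |S|` -/

omit [Fintype G] in
/-- **`Σ_i dim_ℂ (e_i · ℂ[S]) = |S|`** for a complete family of orthogonal idempotents `Σ_i e_i = 1` of `ℚ[G]` (e.g. the rational
central idempotents `{e_W}`: the isotypical decomposition `ℂ[S] = ⊕_W e_W ℂ[S]` has total dimension `|S|`).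
[cite: SerreLinearRepresentations1977, §2.6 Thm. 8 (i), (ii)] [cite: LangeRodriguez2022, §2.8 (2.22) (PDF p. 40)] -/
theorem sum_finrank_range_ofMulAction_eq_card {I : Type} [Fintype I] {e : I → MonoidAlgebra ℚ G}
    (he : CompleteOrthogonalIdempotents e) :
    ∑ i, finrank ℂ (LinearMap.range ((Representation.ofMulAction ℂ G S).asAlgebraHom
        (MonoidAlgebra.mapRingHom G (algebraMap ℚ ℂ) (e i)))) = Fintype.card S := by
  apply Nat.cast_injective (R := ℂ)
  rw [Nat.cast_sum]
  have h : ∀ i, (finrank ℂ (LinearMap.range ((Representation.ofMulAction ℂ G S).asAlgebraHom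
      (MonoidAlgebra.mapRingHom G (algebraMap ℚ ℂ) (e i)))) : ℂ) =
      LinearMap.trace ℂ (MonoidAlgebra ℂ S) ((Representation.ofMulAction ℂ G S).asAlgebraHom
        (MonoidAlgebra.mapRingHom G (algebraMap ℚ ℂ) (e i))) := fun i ↦ by
    have hP : IsIdempotentElem ((Representation.ofMulAction ℂ G S).asAlgebraHom
        (MonoidAlgebra.mapRingHom G (algebraMap ℚ ℂ) (e i))) := by
      rw [IsIdempotentElem, ← map_mul, ((isIdempotentElem_iff_ratToComplex (e i)).1 (he.idem i)).eq]
    have hproj : LinearMap.IsProj (LinearMap.range ((Representation.ofMulAction ℂ G S).asAlgebraHom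
        (MonoidAlgebra.mapRingHom G (algebraMap ℚ ℂ) (e i)))) ((Representation.ofMulAction ℂ G S).asAlgebraHom
        (MonoidAlgebra.mapRingHom G (algebraMap ℚ ℂ) (e i))) :=
      LinearMap.IsIdempotentElem.isProj_range _ hP
    rw [hproj.trace]
  simp_rw [h]
  rw [← map_sum, ← map_sum, ← map_sum, he.complete, map_one, map_one, LinearMap.trace_one,
    finrank_eq_card_basis (MonoidAlgebra.basis S ℂ)]

/-! ## §4 In terms of characters: `dim (e_W · V) = Σ_{ψ ∈ 𝒮(χ)} ψ(1) ⟨ψ, χ_V⟩` -/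

section Characters

variable {V : Type} [AddCommGroup V] [Module ℂ V] [FiniteDimensional ℂ V] (ρ : Representation ℂ G V)

/-- **`tr(e_ℚ(χ) | V) = Σ_{ψ ∈ 𝒮(χ)} ψ(1) · ⟨ψ, χ_V⟩`** for the Galois-class idempotent `e_ℚ(χ) = Σ_{ψ ∈ 𝒮(χ)} e_ψ`: each `e_ψ` acts as
Serre's projector `p_ψ` with `tr p_ψ = ψ(1) ⟨ψ, χ_V⟩` (the tree's `Representation.asAlgebraHom_charIdempotent`, `trace_isotypicProj`).
[cite: SerreLinearRepresentations1977, §2.6 Thm. 8 (ii)] [cite: LangeRodriguez2022, §2.8 (2.20)–(2.23) (PDF pp. 39–40)] -/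
theorem trace_asAlgebraHom_galoisClassIdempotent_eq (χ : G → ℂ) :
    LinearMap.trace ℂ V (ρ.asAlgebraHom (galoisClassIdempotent χ)) =
      ∑ ψ ∈ galoisClass χ, ψ 1 * classInner ψ ρ.character := by
  rw [galoisClassIdempotent, map_sum, map_sum]
  exact Finset.sum_congr rfl fun ψ _ ↦ by rw [Representation.asAlgebraHom_charIdempotent, trace_isotypicProj]

/-- **`dim_ℂ (e_W · V) = Σ_{ψ ∈ 𝒮(χ)} ψ(1) · ⟨ψ, χ_V⟩`** for the rational central idempotent `e_W = e_ℚ(χ)` of an IRREDUCIBLE `χ`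
(`e_W` acting through `ℚ[G] → ℂ[G]`; the dimension of the `W`-isotypical component of `V`, `W` the irreducible rational
representation containing `χ`). [cite: SerreLinearRepresentations1977, §2.6 Thm. 8 (ii)] [cite: LangeRodriguez2022, §2.8 (2.20), (2.23) and §2.9.1 Prop. 2.9.3 (PDF pp. 39–40, 46)] -/
theorem finrank_range_asAlgebraHom_ratCharIdempotent_eq {χ : G → ℂ} (hχ : IsIrrChar G χ) :
    (finrank ℂ (LinearMap.range (ρ.asAlgebraHom (MonoidAlgebra.mapRingHom G (algebraMap ℚ ℂ) (ratCharIdempotent χ)))) : ℂ) =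
      ∑ ψ ∈ galoisClass χ, ψ 1 * classInner ψ ρ.character := by
  have hz := (isIdempotentElem_iff_ratToComplex (ratCharIdempotent χ)).1 (isIdempotentElem_ratCharIdempotent hχ)
  have hP : IsIdempotentElem (ρ.asAlgebraHom (MonoidAlgebra.mapRingHom G (algebraMap ℚ ℂ) (ratCharIdempotent χ))) := by
    rw [IsIdempotentElem, ← map_mul, hz.eq]
  have hproj : LinearMap.IsProj (LinearMap.range (ρ.asAlgebraHom (MonoidAlgebra.mapRingHom G (algebraMap ℚ ℂ)
      (ratCharIdempotent χ)))) (ρ.asAlgebraHom (MonoidAlgebra.mapRingHom G (algebraMap ℚ ℂ) (ratCharIdempotent χ))) :=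
    LinearMap.IsIdempotentElem.isProj_range _ hP
  rw [← hproj.trace, ratToComplex_ratCharIdempotent hχ.isCharacter, trace_asAlgebraHom_galoisClassIdempotent_eq]

end Characters

/-- **`dim_ℂ (e_W · ℂ[S]) = Σ_{ψ ∈ 𝒮(χ)} ψ(1) · ⟨ψ, π⟩`** with the permutation character `π(g) = |S^g|`.
[cite: SerreLinearRepresentations1977, §2.6 Thm. 8 (ii) and §2.3 Ex. 2.2] [cite: JamesLiebeck2001, Ch. 29 p. 340] -/
theorem finrank_range_ofMulAction_ratCharIdempotent_eq {χ : G → ℂ} (hχ : IsIrrChar G χ) :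
    (finrank ℂ (LinearMap.range ((Representation.ofMulAction ℂ G S).asAlgebraHom
        (MonoidAlgebra.mapRingHom G (algebraMap ℚ ℂ) (ratCharIdempotent χ)))) : ℂ) =
      ∑ ψ ∈ galoisClass χ, ψ 1 * classInner ψ (fun g : G ↦ (Nat.card (fixedBy S g) : ℂ)) := by
  rw [finrank_range_asAlgebraHom_ratCharIdempotent_eq _ hχ, character_ofMulAction_eq]

/-- A class function invariant under all `g ↦ g^m`, `(m, |G|) = 1`, is alone in its Galois class: `𝒮(χ) = {χ}`
(e.g. a rational-valued character such as a permutation character). [cite: Isaacs1976, Ch. 9 p. 152 (Galois conjugate characters)] -/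
theorem galoisClass_eq_singleton_of_forall_pow {χ : G → ℂ}
    (h : ∀ m : ℕ, (Fintype.card G).Coprime m → (fun g : G ↦ χ (g ^ m)) = χ) : galoisClass χ = {χ} := by
  ext ψ
  rw [mem_galoisClass_iff, Finset.mem_singleton]
  constructor
  · rintro ⟨m, hm, rfl⟩
    exact h m hm
  · rintro rfl
    exact IsGaloisConj.refl _

omit [Fintype S] in
/-- **`S^{g^m} = S^g` for `(m, |G|) = 1`** (`g` and `g^m` generate the same cyclic group). [folklore] -/
private theorem fixedBy_pow_eq_of_coprime {m : ℕ} (hm : (Fintype.card G).Coprime m) (g : G) :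
    fixedBy S (g ^ m) = fixedBy S g := by
  have key : ∀ (x : G) (k : ℕ) (s : S), x • s = s → x ^ k • s = s := fun x k s hx ↦ by
    induction k with
    | zero => rw [pow_zero, one_smul]
    | succ k ih => rw [pow_succ, mul_smul, hx, ih]
  refine Set.Subset.antisymm (fun s hs ↦ ?_) (fun s hs ↦ ?_)
  · obtain ⟨k, hk⟩ := exists_pow_eq_self_of_coprime (Nat.Coprime.coprime_dvd_right (orderOf_dvd_card (x := g)) hm.symm)
    rw [mem_fixedBy] at hs ⊢
    conv_lhs => rw [← hk]
    exact key _ k s hs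
  · rw [mem_fixedBy] at hs ⊢
    exact key g m s hs

omit [Fintype S] in
/-- **The permutation character is alone in its Galois class**: `𝒮(π) = {π}` (`|S^{g^m}| = |S^g|` for `(m, |G|) = 1`).
[cite: Isaacs1976, Ch. 9 p. 152] [cite: JamesLiebeck2001, Ch. 29 p. 340] -/
theorem galoisClass_natCard_fixedBy :
    galoisClass (fun g : G ↦ (Nat.card (fixedBy S g) : ℂ)) = {fun g : G ↦ (Nat.card (fixedBy S g) : ℂ)} :=
  galoisClass_eq_singleton_of_forall_pow fun m hm ↦ funext fun g ↦ by
    simp only [fixedBy_pow_eq_of_coprime hm g]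

omit [Fintype S] in
/-- `𝒮(π − 1) = {π − 1}` likewise. [cite: Isaacs1976, Ch. 9 p. 152] [cite: JamesLiebeck2001, Cor. 29.10] -/
theorem galoisClass_natCard_fixedBy_sub_one :
    galoisClass (fun g : G ↦ (Nat.card (fixedBy S g) : ℂ) - 1) = {fun g : G ↦ (Nat.card (fixedBy S g) : ℂ) - 1} :=
  galoisClass_eq_singleton_of_forall_pow fun m hm ↦ funext fun g ↦ by
    simp only [fixedBy_pow_eq_of_coprime hm g]

/-- The principal character is irreducible (`⟨1, 1⟩ = 1`). [folklore] -/
private theorem isIrrChar_one' : IsIrrChar G (1 : G → ℂ) := by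
  classical
  refine isCharacter_one.isIrrChar_of_classInner_eq_one ?_
  rw [classInner_apply]
  simp only [Pi.one_apply, mul_one, Finset.sum_const, Finset.card_univ, nsmul_eq_mul]
  rw [inv_mul_cancel₀ (Nat.cast_ne_zero.mpr Fintype.card_ne_zero)]

/-- **The trivial representation: `dim (e_1 · ℂ[S]) = |G\S|`**, the number of orbits (`𝒮(1) = {1}`, `⟨1, π⟩ = |G\S|` by Burnside;
`e_1 = |G|⁻¹ Σ_g g` projects onto the invariants `ℂ[S]^G`). [cite: JamesLiebeck2001, Prop. 29.4] [cite: SerreLinearRepresentations1977, §2.3 Ex. 2.6 (a) and §2.6 Thm. 8 (ii)] -/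
theorem finrank_range_ofMulAction_ratCharIdempotent_one :
    finrank ℂ (LinearMap.range ((Representation.ofMulAction ℂ G S).asAlgebraHom
        (MonoidAlgebra.mapRingHom G (algebraMap ℚ ℂ) (ratCharIdempotent (1 : G → ℂ))))) =
      Nat.card (orbitRel.Quotient G S) := by
  apply Nat.cast_injective (R := ℂ)
  rw [finrank_range_ofMulAction_ratCharIdempotent_eq isIrrChar_one',
    galoisClass_eq_singleton_of_forall_pow (χ := (1 : G → ℂ)) fun m _ ↦ rfl, Finset.sum_singleton, Pi.one_apply, one_mul,
    classInner_comm, classInner_natCard_fixedBy_one]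

/-! ## §5 Doubly transitive actions: `ℂ[S] = 1 ⊕ θ`, `dim (e_θ · ℂ[S]) = |S| − 1`, `dim (e_W · ℂ[S]) = 0` otherwise -/

section TwoTransitive

variable [Nontrivial S]

/-- **`dim (e_θ · ℂ[S]) = |S| − 1` for a 2-TRANSITIVE action**, `θ = π − 1` the non-trivial constituent of `π = 1 + θ`
(irreducible, James–Liebeck 29.10; `𝒮(θ) = {θ}`, `⟨θ, π⟩ = ⟨θ, 1⟩ + ⟨θ, θ⟩ = 0 + 1`, `θ(1) = |S| − 1`).
[cite: JamesLiebeck2001, Cor. 29.10] [cite: Isaacs1976, Cor. 5.17] [cite: SerreLinearRepresentations1977, §2.3 Ex. 2.6 and §2.6 Thm. 8 (ii)] -/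
theorem finrank_range_ofMulAction_ratCharIdempotent_sub_one (h2 : IsMultiplyPretransitive G S 2) :
    finrank ℂ (LinearMap.range ((Representation.ofMulAction ℂ G S).asAlgebraHom
        (MonoidAlgebra.mapRingHom G (algebraMap ℚ ℂ) (ratCharIdempotent fun g : G ↦ (Nat.card (fixedBy S g) : ℂ) - 1)))) =
      Fintype.card S - 1 := by
  obtain ⟨ψ, hψ, hne, hπ⟩ := exists_isIrrChar_eq_one_add_of_isMultiplyPretransitive h2
  have hθ : (fun g : G ↦ (Nat.card (fixedBy S g) : ℂ) - 1) = ψ := by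
    funext g
    have hg := congrFun hπ g
    simp only [Pi.add_apply, Pi.one_apply] at hg
    rw [hg]; ring
  have hψ1 : ψ 1 = (Fintype.card S : ℂ) - 1 := by
    rw [← congrFun hθ 1]
    simp only [natCard_fixedBy_one, Nat.card_eq_fintype_card]
  have hinner : classInner ψ (fun g : G ↦ (Nat.card (fixedBy S g) : ℂ)) = 1 := by
    rw [hπ, classInner_comm, classInner_add_left, isIrrChar_one'.classInner_eq hψ, if_neg hne.symm,
      hψ.classInner_eq hψ, if_pos rfl, zero_add]
  apply Nat.cast_injective (R := ℂ)
  rw [finrank_range_ofMulAction_ratCharIdempotent_eq (hθ ▸ hψ), galoisClass_natCard_fixedBy_sub_one, Finset.sum_singleton,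
    hθ, hψ1, hinner, mul_one, Nat.cast_sub Fintype.card_pos, Nat.cast_one]

/-- **`dim (e_W · ℂ[S]) = 0` for a 2-TRANSITIVE action and every irreducible `χ ∉ {1, θ}`**: no other irreducible rational
representation occurs in `ℚ[S] = 1 ⊕ θ` (every `ψ ∈ 𝒮(χ)` is irreducible with `⟨ψ, π⟩ = ⟨ψ, 1⟩ + ⟨ψ, θ⟩ = 0`, since `𝒮(1) = {1}`,
`𝒮(θ) = {θ}`). [cite: JamesLiebeck2001, Cor. 29.10] [cite: Isaacs1976, Cor. 5.17] [cite: SerreLinearRepresentations1977, §2.6 Thm. 8 (ii)] -/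
theorem finrank_range_ofMulAction_ratCharIdempotent_eq_zero (h2 : IsMultiplyPretransitive G S 2) {χ : G → ℂ}
    (hχ : IsIrrChar G χ) (h1 : χ ≠ 1) (hθ : χ ≠ fun g : G ↦ (Nat.card (fixedBy S g) : ℂ) - 1) :
    finrank ℂ (LinearMap.range ((Representation.ofMulAction ℂ G S).asAlgebraHom
        (MonoidAlgebra.mapRingHom G (algebraMap ℚ ℂ) (ratCharIdempotent χ)))) = 0 := by
  obtain ⟨ψ, hψ, hne, hπ⟩ := exists_isIrrChar_eq_one_add_of_isMultiplyPretransitive h2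
  have hθψ : (fun g : G ↦ (Nat.card (fixedBy S g) : ℂ) - 1) = ψ := by
    funext g
    have hg := congrFun hπ g
    simp only [Pi.add_apply, Pi.one_apply] at hg
    rw [hg]; ring
  have hsum : ∑ φ ∈ galoisClass χ, φ 1 * classInner φ (fun g : G ↦ (Nat.card (fixedBy S g) : ℂ)) = 0 := by
    refine Finset.sum_eq_zero fun φ hφ ↦ ?_
    have hc : IsGaloisConj χ φ := mem_galoisClass_iff.1 hφ
    have hφ_irr : IsIrrChar G φ := hc.isIrrChar hχ
    have hφ1 : φ ≠ 1 := by
      rintro rfl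
      have : χ ∈ galoisClass (1 : G → ℂ) := mem_galoisClass_iff.2 hc.symm
      rw [galoisClass_eq_singleton_of_forall_pow (χ := (1 : G → ℂ)) fun m _ ↦ rfl, Finset.mem_singleton] at this
      exact h1 this
    have hφθ : φ ≠ ψ := by
      rintro rfl
      have : χ ∈ galoisClass (fun g : G ↦ (Nat.card (fixedBy S g) : ℂ) - 1) := hθψ ▸ mem_galoisClass_iff.2 hc.symm
      rw [galoisClass_natCard_fixedBy_sub_one, Finset.mem_singleton] at this
      exact hθ this
    rw [hπ, classInner_comm, classInner_add_left, isIrrChar_one'.classInner_eq hφ_irr, if_neg hφ1.symm,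
      hψ.classInner_eq hφ_irr, if_neg hφθ.symm, add_zero, mul_zero]
  apply Nat.cast_injective (R := ℂ)
  rw [finrank_range_ofMulAction_ratCharIdempotent_eq hχ, hsum, Nat.cast_zero]

end TwoTransitive

/-! ## §6 The regular module: `dim (e_W · ℂ[G]) = |𝒮(χ)| · χ(1)²` -/

section Regular

omit [Fintype S] [MulAction G S] in
/-- The fixed points of left multiplication: `G^g = G` for `g = 1` and `∅` otherwise, as a count `π_reg(g) = |G| · δ_{g,1}`.
[cite: SerreLinearRepresentations1977, §2.4 (character of the regular representation, Prop. 5 proof)] -/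
theorem natCard_fixedBy_regular [DecidableEq G] (g : G) : Nat.card (fixedBy G g) = if g = 1 then Fintype.card G else 0 := by
  split_ifs with h
  · subst h
    rw [natCard_fixedBy_one, Nat.card_eq_fintype_card]
  · rw [Nat.card_eq_zero]
    left
    refine ⟨fun x ↦ h ?_⟩
    have hx : g * (x : G) = x := x.2
    simpa using hx

omit [Fintype S] [MulAction G S] in
/-- **`⟨ψ, π_reg⟩ = ψ(1)`** for every class function `ψ` and the regular permutation character `π_reg = |G| δ_1`
("each irreducible `W_i` is contained in the regular representation with multiplicity `n_i`"). [cite: SerreLinearRepresentations1977, §2.4 Cor. 1] -/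
theorem classInner_natCard_fixedBy_regular (ψ : G → ℂ) :
    classInner ψ (fun g : G ↦ (Nat.card (fixedBy G g) : ℂ)) = ψ 1 := by
  classical
  rw [classInner_apply]
  simp_rw [natCard_fixedBy_regular, inv_eq_one, Nat.cast_ite, Nat.cast_zero, mul_ite, mul_zero, Finset.sum_ite_eq',
    Finset.mem_univ, if_true]
  rw [mul_comm, mul_assoc, mul_inv_cancel₀ (Nat.cast_ne_zero.2 Fintype.card_ne_zero), mul_one]

omit [Fintype S] [MulAction G S] in
/-- **`dim_ℂ (e_W · ℂ[G]) = |𝒮(χ)| · χ(1)²` for the REGULAR module** and an irreducible `χ` (`Σ_{ψ ∈ 𝒮(χ)} ψ(1) ⟨ψ, π_reg⟩ =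
Σ_{ψ ∈ 𝒮(χ)} ψ(1)²`, and Galois-conjugate characters have the same degree): the dimension of the simple two-sided ideal
`ℂ[G] e_W = ⊕_{ψ ∈ 𝒮(χ)} M_{χ(1)}(ℂ)`. [cite: SerreLinearRepresentations1977, §2.4 Cor. 1 and §2.6 Thm. 8 (ii)]
[cite: LangeRodriguez2022, §2.8 (2.20)–(2.23) (PDF pp. 39–40)] -/
theorem finrank_range_regular_ratCharIdempotent_eq {χ : G → ℂ} (hχ : IsIrrChar G χ) :
    (finrank ℂ (LinearMap.range ((Representation.ofMulAction ℂ G G).asAlgebraHom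
        (MonoidAlgebra.mapRingHom G (algebraMap ℚ ℂ) (ratCharIdempotent χ)))) : ℂ) = (galoisClass χ).card * χ 1 ^ 2 := by
  rw [finrank_range_ofMulAction_ratCharIdempotent_eq hχ, Finset.sum_congr rfl fun ψ hψ ↦ by
    rw [classInner_natCard_fixedBy_regular, (mem_galoisClass_iff.1 hψ).apply_one], Finset.sum_const, nsmul_eq_mul, sq]

omit [Fintype S] [MulAction G S] in
/-- The same with the degree as a natural number `χ(1) = d` and `|𝒮(χ)| = [ℚ(χ):ℚ]`: **`dim (e_W · ℂ[G]) = [ℚ(χ):ℚ] · d²`**.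
[cite: SerreLinearRepresentations1977, §2.4 Cor. 1 and §12.1] [cite: LangeRodriguez2022, §2.8 (2.20) (PDF p. 39)] -/
theorem finrank_range_regular_ratCharIdempotent_eq_finrank_charField_mul {χ : G → ℂ} (hχ : IsIrrChar G χ) {d : ℕ}
    (hd : χ 1 = d) :
    finrank ℂ (LinearMap.range ((Representation.ofMulAction ℂ G G).asAlgebraHom
        (MonoidAlgebra.mapRingHom G (algebraMap ℚ ℂ) (ratCharIdempotent χ)))) = finrank ℚ (charField χ) * d ^ 2 := by
  apply Nat.cast_injective (R := ℂ)
  rw [finrank_range_regular_ratCharIdempotent_eq hχ, card_galoisClass_eq_finrank_charField hχ.isCharacter, hd]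
  push_cast
  ring

omit [Fintype S] [MulAction G S] in
/-- **Every irreducible rational representation occurs in `ℚ[G]`: `dim (e_W · ℂ[G]) > 0`.** [cite: SerreLinearRepresentations1977, §2.4 Cor. 1] -/
theorem finrank_range_regular_ratCharIdempotent_pos {χ : G → ℂ} (hχ : IsIrrChar G χ) :
    0 < finrank ℂ (LinearMap.range ((Representation.ofMulAction ℂ G G).asAlgebraHom
        (MonoidAlgebra.mapRingHom G (algebraMap ℚ ℂ) (ratCharIdempotent χ)))) := by
  obtain ⟨d, -, hd⟩ := hχ.exists_apply_one
  have hdpos : 0 < d := Nat.pos_of_ne_zero fun h0 ↦ hχ.apply_one_ne_zero (by rw [hd, h0, Nat.cast_zero])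
  haveI := finiteDimensional_charField hχ.isCharacter
  rw [finrank_range_regular_ratCharIdempotent_eq_finrank_charField_mul hχ hd]
  exact Nat.mul_pos Module.finrank_pos (pow_pos hdpos 2)

end Regular

/-! ## §7 Coset modules: `dim (e_W · ℂ[G/H]) = |𝒮(χ)| · χ(1) · ⟨Res_H χ, 1_H⟩_H` -/

section Coset

variable (H : Subgroup G) [Fintype H] [Fintype (G ⧸ H)]

omit [Fintype S] [MulAction G S] in
/-- **`dim_ℂ (e_W · ℂ[G/H]) = Σ_{ψ ∈ 𝒮(χ)} ψ(1) · ⟨Res_H ψ, 1_H⟩_H`**: the permutation character of `G/H` is `Ind_H^G 1_H` and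
`⟨ψ, Ind_H^G 1_H⟩_G = ⟨Res_H ψ, 1_H⟩_H` (Frobenius reciprocity), the multiplicity of the trivial representation in `V_ψ|_H`, i.e.
`dim V_ψ^H`. [cite: Isaacs1976, Lemma 5.14] [cite: SerreLinearRepresentations1977, §7.2 Thm. 13 and §2.6 Thm. 8 (ii)] -/
theorem finrank_range_quotient_ratCharIdempotent_eq_sum {χ : G → ℂ} (hχ : IsIrrChar G χ) :
    (finrank ℂ (LinearMap.range ((Representation.ofMulAction ℂ G (G ⧸ H)).asAlgebraHom
        (MonoidAlgebra.mapRingHom G (algebraMap ℚ ℂ) (ratCharIdempotent χ)))) : ℂ) =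
      ∑ ψ ∈ galoisClass χ, ψ 1 * classInner (fun h : H ↦ ψ h) 1 := by
  rw [finrank_range_ofMulAction_ratCharIdempotent_eq hχ, ← indClassFun_one_eq_natCard_fixedBy_quotient H]
  exact Finset.sum_congr rfl fun ψ hψ ↦ by
    rw [classInner_indClassFun_right H 1 ((mem_galoisClass_iff.1 hψ).isIrrChar hχ).isCharacter.isClassFun]

omit [Fintype S] [MulAction G S] [Fintype (G ⧸ H)] in
/-- **`⟨Res_H ψ, 1_H⟩_H` is constant on a Galois class**: `ψ = χ ∘ (· ^ m)` with `(m, |G|) = 1`, and `h ↦ h^m` permutes `H`.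
[cite: Isaacs1976, Ch. 9 p. 152] -/
theorem classInner_restrict_one_eq_of_mem_galoisClass {χ ψ : G → ℂ} (hψ : ψ ∈ galoisClass χ) :
    classInner (fun h : H ↦ ψ h) 1 = classInner (fun h : H ↦ χ h) 1 := by
  obtain ⟨m, hm, rfl⟩ := mem_galoisClass_iff.1 hψ
  have hH : (Nat.card H).Coprime m :=
    Nat.Coprime.coprime_dvd_left ((Subgroup.card_subgroup_dvd_card H).trans (by rw [Nat.card_eq_fintype_card])) hm
  simp only [classInner_apply, Pi.one_apply, mul_one]
  congr 1
  exact Fintype.sum_equiv (powCoprime hH) _ _ fun h ↦ by simp only [powCoprime_apply, Subgroup.coe_pow]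

omit [Fintype S] [MulAction G S] in
/-- **`dim_ℂ (e_W · ℂ[G/H]) = |𝒮(χ)| · χ(1) · ⟨Res_H χ, 1_H⟩_H`** (`= [ℚ(χ):ℚ] · χ(1) · dim V_χ^H`) for an irreducible `χ` in the
rational class `W`: the `W`-isotypical multiplicity of the coset module.  For `H = 1` this is §6 (`⟨χ|_1, 1⟩ = χ(1)`), for `H = G`
it is `δ_{W,1}`. [cite: Isaacs1976, Lemma 5.14] [cite: SerreLinearRepresentations1977, §7.2 Thm. 13 and §2.6 Thm. 8 (ii)]
[cite: LangeRodriguez2022, §2.8 (2.20)–(2.23) (PDF pp. 39–40)] -/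
theorem finrank_range_quotient_ratCharIdempotent_eq {χ : G → ℂ} (hχ : IsIrrChar G χ) :
    (finrank ℂ (LinearMap.range ((Representation.ofMulAction ℂ G (G ⧸ H)).asAlgebraHom
        (MonoidAlgebra.mapRingHom G (algebraMap ℚ ℂ) (ratCharIdempotent χ)))) : ℂ) =
      (galoisClass χ).card * χ 1 * classInner (fun h : H ↦ χ h) 1 := by
  rw [finrank_range_quotient_ratCharIdempotent_eq_sum H hχ, Finset.sum_congr rfl fun ψ hψ ↦ by
    rw [classInner_restrict_one_eq_of_mem_galoisClass H hψ, (mem_galoisClass_iff.1 hψ).apply_one], Finset.sum_const,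
    nsmul_eq_mul, mul_assoc]

omit [Fintype S] [MulAction G S] in
/-- The same with natural-number data `χ(1) = d`, `⟨Res_H χ, 1_H⟩_H = n` (`n = dim V_χ^H`) and `|𝒮(χ)| = [ℚ(χ):ℚ]`:
**`dim (e_W · ℂ[G/H]) = [ℚ(χ):ℚ] · d · n`**. [cite: Isaacs1976, Lemma 5.14] [cite: SerreLinearRepresentations1977, §7.2 Thm. 13 and §12.1] -/
theorem finrank_range_quotient_ratCharIdempotent_eq_finrank_charField_mul {χ : G → ℂ} (hχ : IsIrrChar G χ) {d n : ℕ}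
    (hd : χ 1 = d) (hn : classInner (fun h : H ↦ χ h) 1 = n) :
    finrank ℂ (LinearMap.range ((Representation.ofMulAction ℂ G (G ⧸ H)).asAlgebraHom
        (MonoidAlgebra.mapRingHom G (algebraMap ℚ ℂ) (ratCharIdempotent χ)))) = finrank ℚ (charField χ) * d * n := by
  apply Nat.cast_injective (R := ℂ)
  rw [finrank_range_quotient_ratCharIdempotent_eq H hχ, card_galoisClass_eq_finrank_charField hχ.isCharacter, hd, hn]
  push_cast
  ring

end Coset

end Literature.RepresentationTheory.FiniteGroups
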